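import Summits.ABC.IUTFork.Repair.RHSlotReachGlue
import HarnessLib

/-!
# D-0079 RESCUE sub-cell R-H — row 15 «slotreach», the Σ-LOCAL door: the slot-reach clauses at ONE packet `(p, i+1)` ⟹ multi-reach
# there ⟹ `qRegion (i+1) p ⊆ ⁿ˒°𝒰_{i+1,p}` (ROUND-2 input for «S_H restricted to a stratum Σ», abc-iut-rh-lead 19:48:27Z Q2 «rh2-q2-hull»)

PROOF-ONLY file (D-0012: 0 definitions, 0 `Prop` facts; abc-iut cell, rung LADDER-ABC:A2.RP → A2.RESCUE-H; seat abc-iut-rp-d3 gen 5, k2 desk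
hand of record for row 15). TAKES NO SIDE on [IUTchIII] Cor. 3.12 or on any author; the clauses assumed are those of the R-H CANDIDATE
`RHSlotReach.SlotReachWindow` (abc-iut-lens-wuc-1 / abc-iut-rh-typ-12 p457641) = a HYPOTHESIS SHAPE; typed ≠ proved; instantiated ≠ endorsed.
The proof is this seat's `RHSlotReachGlue.multiReach_of_slotReachWindow` (p462301) VERBATIM with the global hypothesis `hH` replaced by its
value `hH p i` at one prime and one label — nothing else is used there, so the door LOCALISES: a stratum `Σ` of packets `(p, i+1)` on which
the clauses hold gives the (xi-f) inclusion on exactly those packets (and `PilotKummerCompatHull` restricted to `Σ` once rh2-q1-vol types it).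
Inputs BY NAME: `RHLevelMover.exists_mover_of_not_mem_logUnits_fibre` (p461981), abc-iut-w5-d107
`qRegion_subset_thetaHull_settingDHVolSharp_of_multiReach`. [cite: WeilBNT1967, Ch. II §2, Th. 1] [cite: DupuyHilado2025, §3.9, §4.9]
[cite: Mochizuki2012, IUTchIII Cor. 3.12 Step (xi-f) p. 184] [claim: Mochizuki2012, status: disputed]
-/

noncomputable section

open Set Function
open scoped Pointwise

namespace Summit.ABC.IUTFork.Repair.RHSlotReachLocal

open Thm311 Thm311.Real Cor312 Cor312.Setting Cor312Vol Literature.IUT.LogThetaLattice Literature.IUT.LogVolume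
open Literature.NumberTheory.NumberFields NumberField IsDedekindDomain Metric RHLevelMover RHSlotReach RHSlotReachGlue

section Setting

variable {F : Type} [Field F] [NumberField F] (X : PilotData F) {logv : PadicLogs F} (hlog : LogvAnalytic logv)
  (M : Type) [Field M] [NumberField M]
  (archPk : ∀ (j : (thetaIndex X).Label) (vQ : (thetaIndex X).VQ), Set ((logShellsDH X logv).Packet j vQ))
  (archSub : ∀ (j : (thetaIndex X).Label) (v : (thetaIndex X).V),
    Set ((logShellsDH X logv).Packet j ((thetaIndex X).over v)))
  (Ψ : ℤ → ∀ v : (thetaIndex X).V, v ∈ (thetaIndex X).Vbad → Set ((logShellsDH X logv).StarPacket v))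
  (act : ℤ → ∀ v : (thetaIndex X).V, v ∈ (thetaIndex X).Vbad →
    (logShellsDH X logv).StarPacket v → Module.End ℚ ((logShellsDH X logv).StarPacket v))
  (Mmod : ℤ → ∀ j : (thetaIndex X).LabelStar, Set ((logShellsDH X logv).GlobalPacket j.1))
  (region : ℤ → ∀ j : (thetaIndex X).LabelStar, FinDivisor M → ∀ vQ : (thetaIndex X).VQ,
    Set ((logShellsDH X logv).Packet j.1 vQ))
  (n : ℤ) {HT : Type} {LogLink : HT → HT → Type} {IsFull : ∀ {s t : HT}, LogLink s t → Prop}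
  (lat : LGPGaussianLogThetaLattice LogLink IsFull)
  {Frd : Type} {IsoF : Frd → Frd → Type} {Ob : Frd → Type} {realify : Frd → Frd} {Strip : Type}
  {IsoS : Strip → Strip → Type} {Mv : ∀ v : (thetaIndex X).V, v ∈ (thetaIndex X).Vbad → Type}
  [∀ v h, Monoid (Mv v h)]
  (sig : GlobalLGPFrobenioidSignature (thetaIndex X).lstar (thetaIndex X).V (· ∈ (thetaIndex X).Vbad)
    Frd IsoF Ob realify Strip IsoS Mv)
  (split : SplittingMonoids Mv) {ObΔ : Type} {N : ∀ v : (thetaIndex X).V, v ∈ (thetaIndex X).Vbad → Type}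
  [∀ v h, Monoid (N v h)] (qData : QPilotData ObΔ N)
  (tq : ∀ (pp : Nat.Primes) (x : (thetaIndex X).Fibre (.inr pp)), haveI : Fact (pp : ℕ).Prime := ⟨pp.2⟩; kOf X pp.1 x)
  (t : ∀ (pp : Nat.Primes) (_ : Fin X.lstar) (x : (thetaIndex X).Fibre (.inr pp)),
    haveI : Fact (pp : ℕ).Prime := ⟨pp.2⟩; kOf X pp.1 x)
  (htq0 : ∀ pp x, tq pp x ≠ 0)
  (htq1 : ∀ (pp : Nat.Primes) (x : (thetaIndex X).Fibre (.inr pp)),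
    haveI : Fact (pp : ℕ).Prime := ⟨pp.2⟩; placeOf X pp.1 x ∉ X.S → ‖tq pp x‖ = 1)
  (col : ℤ → Column (logShellsDH X logv))
  -- the numeric dictionary of H⋆ (abc-iut-lens-wuc-1): per place `x | p` a uniformizer, the certified inner conductor and outer radius
  (e n₀ : ∀ pp : Nat.Primes, (thetaIndex X).Fibre (.inr pp) → ℕ)
  (lam : ∀ pp : Nat.Primes, (thetaIndex X).Fibre (.inr pp) → ℝ)
  (ϖ : ∀ (pp : Nat.Primes) (x : (thetaIndex X).Fibre (.inr pp)), haveI : Fact (pp : ℕ).Prime := ⟨pp.2⟩; kOf X pp.1 x)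
  (mΘ : ∀ pp : Nat.Primes, Fin (thetaIndex X).lstar → (thetaIndex X).Fibre (.inr pp) → ℤ)
  (mq : ∀ pp : Nat.Primes, (thetaIndex X).Fibre (.inr pp) → ℤ)

/-- **MULTI-REACH AT ONE PACKET FROM THE LOCAL SLOT-REACH CLAUSES** (the Σ-local form of `RHSlotReachGlue.multiReach_of_slotReachWindow`:
only the window clauses at the bad places over THIS prime `p` and THIS label `i+1` are assumed — `hHpi` is `hH p i` of the global
candidate `SlotReachWindow` by `Iff.rfl`), with the
one added binder `htq1` (‖t_{q,x}‖ = 1 off `S`; see the module docstring). At a packet `(p, i, e⃗)` whose last slot sits at a BAD place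
`w`: donor slot `a` at `x_a` carries `y_a = p^{1−C_a}·u_{x_a}`, `C_a = ⌈n₀(x_a)/e_{x_a}⌉`, reached norm `≥ p^{C_a + λ_{x_a}}`; the last slot
carries `t_Θ·y' = p^{1−c}·u_w`, `c = −⌊(m_Θ − n₀(w))/e_w⌋`, reached norm `≥ p^{c + λ_w}`; the product dominates `‖t_{q,w}‖ = p^{−m_q/e_w}`
by the window clause. At a GOOD `w`: identity movers. [cite: WeilBNT1967, Ch. II §2, Th. 1] [cite: DupuyHilado2025, §3.9, §4.9]
[claim: Mochizuki2012, status: disputed] -/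
theorem multiReach_of_slotReachAt
    (htq1 : ∀ (pp : Nat.Primes) (x : (thetaIndex X).Fibre (.inr pp)),
      haveI : Fact (pp : ℕ).Prime := ⟨pp.2⟩; placeOf X pp.1 x ∉ X.S → ‖tq pp x‖ = 1)
    (he : ∀ pp x, 1 ≤ e pp x)
    (hϖ : ∀ (pp : Nat.Primes) (x : (thetaIndex X).Fibre (.inr pp)), haveI : Fact (pp : ℕ).Prime := ⟨pp.2⟩
      ‖ϖ pp x‖ = (pp : ℝ) ^ (-(1 : ℝ) / (e pp x : ℝ)))
    (hsharp : ∀ (pp : Nat.Primes) (x : (thetaIndex X).Fibre (.inr pp)), haveI : Fact (pp : ℕ).Prime := ⟨pp.2⟩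
      ∃ u : kOf X pp.1 x, ‖u‖ ≤ ‖ϖ pp x‖ ^ ((n₀ pp x : ℤ) - 1) ∧ u ∉ (logUnits (kOf X pp.1 x) : Set (kOf X pp.1 x)))
    (hrad : ∀ (pp : Nat.Primes) (x : (thetaIndex X).Fibre (.inr pp)), haveI : Fact (pp : ℕ).Prime := ⟨pp.2⟩
      ∃ z ∈ (logUnits (kOf X pp.1 x) : Set (kOf X pp.1 x)), (pp : ℝ) ^ (lam pp x) ≤ ‖z‖)
    (ht1 : ∀ (pp : Nat.Primes) (i : Fin X.lstar) (x : (thetaIndex X).Fibre (.inr pp)),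
      haveI : Fact (pp : ℕ).Prime := ⟨pp.2⟩; placeOf X pp.1 x ∉ X.S → ‖t pp i x‖ = 1)
    (hΘ : ∀ (pp : Nat.Primes) (i : Fin X.lstar) (w : (thetaIndex X).Fibre (.inr pp)), haveI : Fact (pp : ℕ).Prime := ⟨pp.2⟩
      placeOf X pp.1 w ∈ X.S → ‖t pp i w‖ = ‖ϖ pp w‖ ^ (mΘ pp i w))
    (hq : ∀ (pp : Nat.Primes) (w : (thetaIndex X).Fibre (.inr pp)), haveI : Fact (pp : ℕ).Prime := ⟨pp.2⟩
      placeOf X pp.1 w ∈ X.S → ‖tq pp w‖ = ‖ϖ pp w‖ ^ (mq pp w))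
    (pp : Nat.Primes) (i : Fin (thetaIndex X).lstar)
    (hHpi : ∀ w : (thetaIndex X).Fibre (.inr pp), haveI : Fact (pp : ℕ).Prime := ⟨pp.2⟩; placeOf X pp.1 w ∈ X.S →
      ∀ x : Fin ((i : ℕ) + 1) → (thetaIndex X).Fibre (.inr pp),
        (((mΘ pp i w - n₀ pp w) / (e pp w : ℤ) : ℤ) : ℝ)
          ≤ (mq pp w : ℝ) / (e pp w : ℝ) + lam pp w
            + ∑ a, (lam pp (x a) + ((-((-(n₀ pp (x a) : ℤ)) / (e pp (x a) : ℤ)) : ℤ) : ℝ)))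
    (ev : (thetaIndex X).Caps (Setting.labelSucc i) → (thetaIndex X).Fibre (.inr pp)) :
    haveI : Fact (pp : ℕ).Prime := ⟨pp.2⟩
    ∃ g : (thetaIndex X).Caps (Setting.labelSucc i) → ∀ x : (thetaIndex X).Fibre (.inr pp),
        (logShellsDH X logv).carrier x.1 ≃ₗ[ℚ] (logShellsDH X logv).carrier x.1,
      (∀ a x, g a x ∈ (logShellsDH X logv).ism x.1) ∧
      ∃ y : ∀ a, kOf X pp.1 (ev a), (∀ a, ‖y a‖ ≤ 1) ∧
        ‖tq pp (ev (Fin.last _))‖ ≤ ∏ a, ‖(presAt X hlog pp).φ (ev a) (g a (ev a) (((presAt X hlog pp).φ (ev a)).symm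
          ((if a = Fin.last _ then t pp i (ev a) else 1) * y a)))‖ := by
  haveI : Fact (pp : ℕ).Prime := ⟨pp.2⟩
  classical
  have hp1 : (1 : ℝ) < (pp : ℕ) := by exact_mod_cast pp.2.one_lt
  have hp0 : (0 : ℝ) < (pp : ℕ) := by positivity
  set P := presAt X hlog pp with hP
  set w := ev (Fin.last _) with hwdef
  by_cases hw : placeOf X pp.1 w ∈ X.S
  swap
  · -- GOOD last place: identity movers, `y = 1`
    refine ⟨fun _ _ => LinearEquiv.refl ℚ _, fun _ x => (logShellsDH X logv).one_mem_ism x.1, fun _ => 1,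
      fun _ => norm_one.le, ?_⟩
    have hprod : ∏ a, ‖P.φ (ev a) ((LinearEquiv.refl ℚ _)
        ((P.φ (ev a)).symm ((if a = Fin.last _ then t pp i (ev a) else 1) * (1 : kOf X pp.1 (ev a)))))‖ = 1 := by
      refine Finset.prod_eq_one fun a _ => ?_
      rw [mul_one, LinearEquiv.refl_apply, LinearEquiv.apply_symm_apply]
      split_ifs with ha
      · rw [ha]; exact ht1 pp i w hw
      · exact (norm_one (α := kOf X pp.1 (ev a)))
    rw [hprod, htq1 pp w hw]
  · -- BAD last place: the level movers
    -- the dictionary at the places over `p`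
    choose u hu_norm hu_not using hsharp pp
    choose z hz_mem hz_norm using hrad pp
    -- slot exponents: `c` on the last slot (at `x`), `C_x` on the donor slots
    let κ : (thetaIndex X).Caps (Setting.labelSucc i) → (thetaIndex X).Fibre (.inr pp) → ℤ := fun a x =>
      if a = Fin.last _ then -((mΘ pp i x - n₀ pp x) / (e pp x : ℤ)) else -((-(n₀ pp x : ℤ)) / (e pp x : ℤ))
    -- slot vectors `s_{a,x} = p^{1-κ} • u_x`
    let s : ∀ (a : (thetaIndex X).Caps (Setting.labelSucc i)) (x : (thetaIndex X).Fibre (.inr pp)), kOf X pp.1 x :=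
      fun a x => ((pp : ℚ_[pp]) ^ (1 - κ a x)) • u x
    have hs : ∀ a x, ((pp : ℚ_[pp]) ^ (κ a x - 1)) • s a x = u x := by
      intro a x
      show ((pp : ℚ_[pp]) ^ (κ a x - 1)) • (((pp : ℚ_[pp]) ^ (1 - κ a x)) • u x) = u x
      rw [smul_smul, ← zpow_add₀ (Nat.cast_ne_zero.2 pp.2.ne_zero), show κ a x - 1 + (1 - κ a x) = 0 by ring,
        zpow_zero, one_smul]
    -- movers on every slot and place
    have hmov : ∀ (a : (thetaIndex X).Caps (Setting.labelSucc i)) (x : (thetaIndex X).Fibre (.inr pp)),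
        ∃ g ∈ (logShellsDH X logv).ism x.1,
          ((pp : ℕ) : ℝ) ^ (κ a x) * ‖z x‖ ≤ ‖P.φ x (g ((P.φ x).symm (s a x)))‖ := fun a x =>
      exists_mover_of_not_mem_logUnits_fibre X hlog pp x (hs a x) (hu_not x) (hz_mem x)
    choose g hg hreach using hmov
    -- the Θ-idele at the bad last place is nonzero
    have hϖpos : ∀ x, 0 < ‖ϖ pp x‖ := fun x => by rw [hϖ pp x]; exact Real.rpow_pos_of_pos hp0 _
    have ht0 : t pp i w ≠ 0 := by
      rw [← norm_pos_iff, hΘ pp i w hw]; exact zpow_pos (hϖpos w) _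
    -- the box points
    let y : ∀ a, kOf X pp.1 (ev a) := fun a => if a = Fin.last _ then (t pp i (ev a))⁻¹ * s a (ev a) else s a (ev a)
    have hcy : ∀ a, (if a = Fin.last _ then t pp i (ev a) else 1) * y a = s a (ev a) := by
      intro a
      show (if a = Fin.last _ then t pp i (ev a) else 1) *
          (if a = Fin.last _ then (t pp i (ev a))⁻¹ * s a (ev a) else s a (ev a)) = s a (ev a)
      split_ifs with ha
      · subst ha
        rw [← mul_assoc, mul_inv_cancel₀ ht0, one_mul]
      · rw [one_mul]
    -- norms in `p`-exponent form
    have hnorm_s : ∀ a x, ‖s a x‖ = ((pp : ℕ) : ℝ) ^ (κ a x - 1) * ‖u x‖ := by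
      intro a x
      show ‖((pp : ℚ_[pp]) ^ (1 - κ a x)) • u x‖ = _
      rw [norm_zpow_prime_smul, neg_sub]
    have hϖzpow : ∀ (x : (thetaIndex X).Fibre (.inr pp)) (m : ℤ),
        ‖ϖ pp x‖ ^ m = ((pp : ℕ) : ℝ) ^ (-(m : ℝ) / (e pp x : ℝ)) := by
      intro x m
      rw [← Real.rpow_intCast, hϖ pp x, ← Real.rpow_mul hp0.le]
      congr 1; ring
    have he0 : ∀ x, (0 : ℝ) < (e pp x : ℝ) := fun x => by exact_mod_cast he pp x
    -- `‖u_x‖ ≤ p^{-(n₀-1)/e}`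
    have hu_le : ∀ x, ‖u x‖ ≤ ((pp : ℕ) : ℝ) ^ (-(((n₀ pp x : ℤ) - 1 : ℤ) : ℝ) / (e pp x : ℝ)) := fun x => by
      have h := hu_norm x; rwa [hϖzpow] at h
    -- the box constraints `‖y_a‖ ≤ 1`
    have hy : ∀ a, ‖y a‖ ≤ 1 := by
      intro a
      by_cases ha : a = Fin.last _
      · -- last slot: ‖t⁻¹ s‖ = p^{c-1} ‖u_w‖ / ‖ϖ_w‖^{mΘ} ≤ 1
        have hya : y a = (t pp i (ev a))⁻¹ * s a (ev a) := if_pos ha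
        subst ha
        rw [hya, norm_mul, norm_inv, hnorm_s, hΘ pp i w hw, hϖzpow]
        have hκ : κ (Fin.last _) w = -((mΘ pp i w - n₀ pp w) / (e pp w : ℤ)) := if_pos rfl
        have hint : (e pp w : ℤ) * κ (Fin.last _) w ≤ (n₀ pp w : ℤ) - mΘ pp i w + e pp w - 1 := by
          rw [hκ, show mΘ pp i w - n₀ pp w = -((n₀ pp w : ℤ) - mΘ pp i w) by ring]
          exact mul_neg_ediv_neg_le (e pp w) (he pp w) _
        have hint' : (e pp w : ℝ) * (κ (Fin.last _) w : ℝ) ≤ (n₀ pp w : ℝ) - (mΘ pp i w : ℝ) + (e pp w : ℝ) - 1 := by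
          exact_mod_cast hint
        have hdiv : (κ (Fin.last _) w : ℝ) - 1 ≤ ((n₀ pp w : ℝ) - 1) / (e pp w : ℝ) - (mΘ pp i w : ℝ) / (e pp w : ℝ) := by
          rw [← sub_div, le_div_iff₀ (he0 w)]; linarith
        calc (((pp : ℕ) : ℝ) ^ (-((mΘ pp i w : ℤ) : ℝ) / (e pp w : ℝ)))⁻¹ *
              (((pp : ℕ) : ℝ) ^ (κ (Fin.last _) w - 1) * ‖u w‖)
            ≤ (((pp : ℕ) : ℝ) ^ (-((mΘ pp i w : ℤ) : ℝ) / (e pp w : ℝ)))⁻¹ *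
              (((pp : ℕ) : ℝ) ^ (κ (Fin.last _) w - 1) *
                ((pp : ℕ) : ℝ) ^ (-(((n₀ pp w : ℤ) - 1 : ℤ) : ℝ) / (e pp w : ℝ))) := by
              gcongr; exact hu_le w
          _ ≤ 1 := by
              rw [← Real.rpow_neg hp0.le, ← Real.rpow_intCast, ← Real.rpow_add hp0, ← Real.rpow_add hp0]
              refine Real.rpow_le_one_of_one_le_of_nonpos hp1.le ?_
              push_cast
              simp only [neg_div, neg_neg]
              linarith
      · -- donor slot: ‖s‖ = p^{C-1} ‖u_x‖ ≤ 1
        have hya : y a = s a (ev a) := if_neg ha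
        rw [hya, hnorm_s]
        set x := ev a with hxdef
        have hκ : κ a x = -((-(n₀ pp x : ℤ)) / (e pp x : ℤ)) := if_neg ha
        have hint : (e pp x : ℤ) * κ a x ≤ (n₀ pp x : ℤ) + e pp x - 1 := by
          rw [hκ]; exact mul_neg_ediv_neg_le (e pp x) (he pp x) _
        have hint' : (e pp x : ℝ) * (κ a x : ℝ) ≤ (n₀ pp x : ℝ) + (e pp x : ℝ) - 1 := by exact_mod_cast hint
        have hdiv : (κ a x : ℝ) - 1 ≤ ((n₀ pp x : ℝ) - 1) / (e pp x : ℝ) := by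
          rw [le_div_iff₀ (he0 x)]; linarith
        calc ((pp : ℕ) : ℝ) ^ (κ a x - 1) * ‖u x‖
            ≤ ((pp : ℕ) : ℝ) ^ (κ a x - 1) * ((pp : ℕ) : ℝ) ^ (-(((n₀ pp x : ℤ) - 1 : ℤ) : ℝ) / (e pp x : ℝ)) := by
              gcongr; exact hu_le x
          _ ≤ 1 := by
              rw [← Real.rpow_intCast, ← Real.rpow_add hp0]
              refine Real.rpow_le_one_of_one_le_of_nonpos hp1.le ?_
              push_cast
              simp only [neg_div]
              linarith
    refine ⟨g, hg, y, hy, ?_⟩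
    -- each factor dominates `p^{κ} · p^{λ}`
    have hfac : ∀ a, ((pp : ℕ) : ℝ) ^ ((κ a (ev a) : ℝ) + lam pp (ev a)) ≤
        ‖P.φ (ev a) (g a (ev a) ((P.φ (ev a)).symm ((if a = Fin.last _ then t pp i (ev a) else 1) * y a)))‖ := by
      intro a
      rw [hcy a, Real.rpow_add hp0, Real.rpow_intCast]
      exact (mul_le_mul_of_nonneg_left (hz_norm (ev a)) (zpow_nonneg hp0.le _)).trans (hreach a (ev a))
    have hprod : ((pp : ℕ) : ℝ) ^ (∑ a, ((κ a (ev a) : ℝ) + lam pp (ev a))) ≤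
        ∏ a, ‖P.φ (ev a) (g a (ev a) ((P.φ (ev a)).symm ((if a = Fin.last _ then t pp i (ev a) else 1) * y a)))‖ := by
      rw [Real.rpow_sum_of_pos hp0]
      exact Finset.prod_le_prod (fun a _ => (Real.rpow_pos_of_pos hp0 _).le) fun a _ => hfac a
    refine le_trans ?_ hprod
    -- the window clause at `(w, i, donors)`
    have key : ((((mΘ pp i w - n₀ pp w) / (e pp w : ℤ) : ℤ) : ℝ))
        ≤ (mq pp w : ℝ) / (e pp w : ℝ) + lam pp w
          + ∑ a : Fin ((i : ℕ) + 1), (lam pp (ev (Fin.castSucc a))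
            + ((-((-(n₀ pp (ev (Fin.castSucc a)) : ℤ)) / (e pp (ev (Fin.castSucc a)) : ℤ)) : ℤ) : ℝ)) :=
      hHpi w hw fun a => ev (Fin.castSucc a)
    rw [hq pp w hw, hϖzpow]
    refine Real.rpow_le_rpow_of_exponent_le hp1.le ?_
    -- split the slot sum: donors + last
    have hlast : κ (Fin.last _) (ev (Fin.last _)) = -((mΘ pp i w - n₀ pp w) / (e pp w : ℤ)) := if_pos rfl
    have hdon : ∀ a : Fin ((i : ℕ) + 1), κ (Fin.castSucc a) (ev (Fin.castSucc a))
        = -((-(n₀ pp (ev (Fin.castSucc a)) : ℤ)) / (e pp (ev (Fin.castSucc a)) : ℤ)) :=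
      fun a => if_neg (Fin.castSucc_lt_last a).ne
    have hsplit : ∑ a, ((κ a (ev a) : ℝ) + lam pp (ev a))
        = (∑ a : Fin ((i : ℕ) + 1), (lam pp (ev (Fin.castSucc a))
            + ((-((-(n₀ pp (ev (Fin.castSucc a)) : ℤ)) / (e pp (ev (Fin.castSucc a)) : ℤ)) : ℤ) : ℝ)))
          + (-((((mΘ pp i w - n₀ pp w) / (e pp w : ℤ) : ℤ) : ℝ)) + lam pp w) := by
      rw [Fin.sum_univ_castSucc, hlast, Int.cast_neg]
      congr 1
      exact Finset.sum_congr rfl fun a _ => by rw [hdon a, add_comm]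
    rw [hsplit]
    set S := ∑ a : Fin ((i : ℕ) + 1), (lam pp (ev (Fin.castSucc a))
      + ((-((-(n₀ pp (ev (Fin.castSucc a)) : ℤ)) / (e pp (ev (Fin.castSucc a)) : ℤ)) : ℤ) : ℝ)) with hS
    have hneg : -((mq pp w : ℤ) : ℝ) / (e pp w : ℝ) = -((mq pp w : ℝ) / (e pp w : ℝ)) := by rw [neg_div]
    rw [hneg]
    linarith [key]


/-- **The (xi-f) inclusion at ONE packet from the local clauses**: `qRegion (i+1) p ⊆ thetaHull (i+1) p` at `settingPrVolSharp` (the sets are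
those of `settingDHVolSharp`), by abc-iut-w5-d107's packet assembly. This is the door a stratum `Σ ∋ (p, i+1)` uses packet by packet.
[cite: DupuyHilado2025, §3.9, §4.9] [claim: Mochizuki2012, status: disputed] -/
theorem qRegion_subset_thetaHull_settingPrVolSharp_of_slotReachAt
    (htq1 : ∀ (pp : Nat.Primes) (x : (thetaIndex X).Fibre (.inr pp)),
      haveI : Fact (pp : ℕ).Prime := ⟨pp.2⟩; placeOf X pp.1 x ∉ X.S → ‖tq pp x‖ = 1)
    (he : ∀ pp x, 1 ≤ e pp x)
    (hϖ : ∀ (pp : Nat.Primes) (x : (thetaIndex X).Fibre (.inr pp)), haveI : Fact (pp : ℕ).Prime := ⟨pp.2⟩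
      ‖ϖ pp x‖ = (pp : ℝ) ^ (-(1 : ℝ) / (e pp x : ℝ)))
    (hsharp : ∀ (pp : Nat.Primes) (x : (thetaIndex X).Fibre (.inr pp)), haveI : Fact (pp : ℕ).Prime := ⟨pp.2⟩
      ∃ u : kOf X pp.1 x, ‖u‖ ≤ ‖ϖ pp x‖ ^ ((n₀ pp x : ℤ) - 1) ∧ u ∉ (logUnits (kOf X pp.1 x) : Set (kOf X pp.1 x)))
    (hrad : ∀ (pp : Nat.Primes) (x : (thetaIndex X).Fibre (.inr pp)), haveI : Fact (pp : ℕ).Prime := ⟨pp.2⟩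
      ∃ z ∈ (logUnits (kOf X pp.1 x) : Set (kOf X pp.1 x)), (pp : ℝ) ^ (lam pp x) ≤ ‖z‖)
    (ht1 : ∀ (pp : Nat.Primes) (i : Fin X.lstar) (x : (thetaIndex X).Fibre (.inr pp)),
      haveI : Fact (pp : ℕ).Prime := ⟨pp.2⟩; placeOf X pp.1 x ∉ X.S → ‖t pp i x‖ = 1)
    (hΘ : ∀ (pp : Nat.Primes) (i : Fin X.lstar) (w : (thetaIndex X).Fibre (.inr pp)), haveI : Fact (pp : ℕ).Prime := ⟨pp.2⟩
      placeOf X pp.1 w ∈ X.S → ‖t pp i w‖ = ‖ϖ pp w‖ ^ (mΘ pp i w))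
    (hq : ∀ (pp : Nat.Primes) (w : (thetaIndex X).Fibre (.inr pp)), haveI : Fact (pp : ℕ).Prime := ⟨pp.2⟩
      placeOf X pp.1 w ∈ X.S → ‖tq pp w‖ = ‖ϖ pp w‖ ^ (mq pp w))
    (pp : Nat.Primes) (i : Fin (thetaIndex X).lstar)
    (hHpi : ∀ w : (thetaIndex X).Fibre (.inr pp), haveI : Fact (pp : ℕ).Prime := ⟨pp.2⟩; placeOf X pp.1 w ∈ X.S →
      ∀ x : Fin ((i : ℕ) + 1) → (thetaIndex X).Fibre (.inr pp),
        (((mΘ pp i w - n₀ pp w) / (e pp w : ℤ) : ℤ) : ℝ)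
          ≤ (mq pp w : ℝ) / (e pp w : ℝ) + lam pp w
            + ∑ a, (lam pp (x a) + ((-((-(n₀ pp (x a) : ℤ)) / (e pp (x a) : ℤ)) : ℤ) : ℝ))) :
    (settingPrVolSharp X hlog M archPk archSub Ψ act Mmod region n lat sig split qData tq t htq0 htq1).qRegion (Setting.labelSucc i)
        (.inr pp) ⊆
      (settingPrVolSharp X hlog M archPk archSub Ψ act Mmod region n lat sig split qData tq t htq0 htq1).thetaHull (Setting.labelSucc i)
        (.inr pp) :=
  qRegion_subset_thetaHull_settingDHVolSharp_of_multiReach X hlog M archPk archSub Ψ act Mmod region n lat sig split qData tq t htq0 htq1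
    pp i (multiReach_of_slotReachAt X hlog tq t e n₀ lam ϖ mΘ mq htq1 he hϖ hsharp hrad ht1 hΘ hq pp i hHpi)

/-- The global candidate's clauses ARE the local ones: `SlotReachWindow … ⟹ hHpi` at every `(p, i)` (`Iff.rfl` unfolding; recorded so that
the ROUND-1 door `RHSlotReachGlue.multiReach_of_slotReachWindow` is visibly the everywhere-case of the local door). [folklore] -/
theorem slotReachAt_of_slotReachWindow
    (hH : SlotReachWindow (thetaIndex X).lstar (fun pp => (thetaIndex X).Fibre (.inr pp))
      (fun pp w => haveI : Fact (pp : ℕ).Prime := ⟨pp.2⟩; placeOf X pp.1 w ∈ X.S) e n₀ lam mΘ mq)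
    (pp : Nat.Primes) (i : Fin (thetaIndex X).lstar) :
    ∀ w : (thetaIndex X).Fibre (.inr pp), haveI : Fact (pp : ℕ).Prime := ⟨pp.2⟩; placeOf X pp.1 w ∈ X.S →
      ∀ x : Fin ((i : ℕ) + 1) → (thetaIndex X).Fibre (.inr pp),
        (((mΘ pp i w - n₀ pp w) / (e pp w : ℤ) : ℤ) : ℝ)
          ≤ (mq pp w : ℝ) / (e pp w : ℝ) + lam pp w
            + ∑ a, (lam pp (x a) + ((-((-(n₀ pp (x a) : ℤ)) / (e pp (x a) : ℤ)) : ℤ) : ℝ)) :=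
  hH pp i

end Setting

end Summit.ABC.IUTFork.Repair.RHSlotReachLocal

end
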